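import Literature.NumberTheory.EllipticCurves.Isogeny
import Literature.NumberTheory.EllipticCurves.VariableChangePointsMap
import HarnessLib

/-!
# The isogeny of an admissible change of variables

Sibling file of `Literature.NumberTheory.EllipticCurves.Isogeny` (D-0014 append protocol). An
admissible change of variables `C = (u, r, s, t)` over `K` (Mathlib `WeierstrassCurve.VariableChange`,
acting by `C • W`) is an isomorphism `W ≅ C • W` of Weierstrass curves over `K` (Silverman, *The
Arithmetic of Elliptic Curves*, III.3.1(b): any two Weierstrass equations for `E` are related by
a linear change of variables `x = u²x' + r`, `y = u³y' + su²x' + t`); an isomorphism fixing `O`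
is in particular an isogeny (III.4, Definition: an isogeny is a morphism `φ : E₁ → E₂` with
`φ(O) = O`), and it has degree one (conversely a map of degree one between smooth curves is an
isomorphism, II.2.4.1). This file records it as a term of the prelude structure
`WeierstrassCurve.Isogeny W (C • W)`:

* the underlying homomorphism of `K̄`-points is the tree's substitution isomorphism
  `VariableChange.pointEquivBaseChange W C K̄ : W(K̄) ≃+ (C • W)(K̄)`,
  `(x, y) ↦ (u⁻²(x - r), u⁻³(y - s(x - r) - t))` (`VariableChangePointsMap.lean`; the same map is
  called `WeierstrassCurve.geomPointsEquiv` in `BSDInvariantsProofs.lean`, which is not imported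
  here to keep this file light);
* it agrees with the polynomial map `(toXPoly C, toYPoly C)` at every affine point
  (`agreesWithRationalMapAt_pointEquivBaseChange`), so it is `IsAlgebraicOn` with exceptional
  set `{O}`;
* it is `Γ_K`-equivariant (`VariableChange.pointEquivBaseChange_map_algEquiv`: the substitution
  has coefficients in `K`);
* it is injective, so its kernel `{O}` is finite and its degree (`#ker`) is `1`.

## Contents

* `WeierstrassCurve.VariableChange.toXPoly`, `toYPoly`: the substitution as polynomials over `K̄`
  (`eval_toXPoly`, `eval_toYPoly`), and `agreesWithRationalMapAt_pointEquivBaseChange`,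
  `isAlgebraicOn_pointEquivBaseChange`.
* `WeierstrassCurve.VariableChange.toIsogeny W C : Isogeny W (C • W)`, with `toIsogeny_apply`,
  `toIsogeny_some`, `toIsogeny_injective`, `toIsogeny_surjective`, `ker_toIsogeny`,
  `degree_toIsogeny`, `isCyclic_toIsogeny`.
* `WeierstrassCurve.isIsogenous_smul W C : IsIsogenous W (C • W)` and
  `WeierstrassCurve.isIsogenous_of_smul W C : IsIsogenous (C • W) W` (the inverse change of
  variables `C⁻¹`, using `C⁻¹ • C • W = W`); `isIsogenous_of_smul_eq`, `isIsogenous_of_smul_eq'`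
  (the forms `C • W = W' → W ~ W'`, `W' ~ W`).

Mathlib has no isogenies; `lean search` for `toIsogeny`, `isIsogenous_smul`,
`isIsogenous_of_smul`, `isIsogenous_variableChange` in `Literature/` found nothing. The tree has
the identity isogeny (`IsogenyIdProofs.lean`), sums/negatives (`IsogenyHomProofs.lean`), the point
isomorphism of a change of variables (`VariableChangePoints{,Map}.lean`, on which this file
builds), and — in `ComplexMultiplicationBSDTripleProofs.lean`, which imports the BSD invariants
and global minimal models — the post-composition `Isogeny.smul φ C : Isogeny W (C • W')` of an
isogeny with a change of variables of the target, with `IsIsogenous.smul_right`. The isogeny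
`toIsogeny W C` below *is* that object for `φ = Isogeny.id W` (`IsogenyIdProofs.lean`): in a file
importing both, `toIsogeny W C = (Isogeny.id W).smul C` holds by `Isogeny.ext fun _ => rfl`
(to be recorded as `toIsogeny_eq_id_smul` there, or `Isogeny.smul`/`smul_right` moved down to
this file). It is constructed directly here so that this basic fact stays next to `Isogeny.lean`
with light imports (`Isogeny`, `VariableChangePointsMap` only), and the file adds what
`smul_right` does not give: the explicit formulae, injectivity/surjectivity, degree `1`, and the
*opposite* direction `IsIsogenous (C • W) W` (`isIsogenous_of_smul`, from `C⁻¹`).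

## References

* J. H. Silverman, *The Arithmetic of Elliptic Curves*, 2nd ed., GTM 106 (2009), II.2.4.1
  (a map of degree one between smooth curves is an isomorphism), III.1 (p. 42 and Table 3.1: the
  substitution), III.3.1(b) (Weierstrass equations of `E` differ by a linear change of
  variables), III.4 (Definition of isogeny), III.6.
-/

noncomputable section

open scoped Classical

universe u

namespace WeierstrassCurve

open MvPolynomial

variable {K : Type u} [Field K]

/-- Constructor for the prelude's `AgreesWithRationalMapAt` at an affine point `(x, y)`, with the
coordinates of the value `f (x, y) = (a, b)` given up to provable equalities
`a = P₁(x,y)/Q₁(x,y)`, `b = P₂(x,y)/Q₂(x,y)` (avoids dependent rewriting under the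
nonsingularity proof). [folklore] -/
theorem agreesWithRationalMapAt_some_of_eq {W W' : WeierstrassCurve K}
    {P₁ Q₁ P₂ Q₂ : MvPolynomial (Fin 2) (AlgebraicClosure K)} {f : W.geomPoints → W'.geomPoints}
    {x y : AlgebraicClosure K} (h : (W.baseChange (AlgebraicClosure K)).toAffine.Nonsingular x y)
    {a b : AlgebraicClosure K} (hab : (W'.baseChange (AlgebraicClosure K)).toAffine.Nonsingular a b)
    (hf : f (Affine.Point.some x y h) = (Affine.Point.some a b hab : W'.geomPoints))
    (hQ₁ : eval ![x, y] Q₁ ≠ 0) (hQ₂ : eval ![x, y] Q₂ ≠ 0)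
    (ha : a = eval ![x, y] P₁ / eval ![x, y] Q₁) (hb : b = eval ![x, y] P₂ / eval ![x, y] Q₂) :
    AgreesWithRationalMapAt W W' P₁ Q₁ P₂ Q₂ f (Affine.Point.some x y h) := by
  subst ha hb
  exact ⟨x, y, h, rfl, hQ₁, hQ₂, hab, hf⟩

variable (W : WeierstrassCurve K) (C : VariableChange K)

namespace VariableChange

/-! ## The substitution as a polynomial map over `K̄` -/

/-- The new `x`-coordinate `u⁻²(x - r)` as a polynomial in `x, y` with coefficients in `K̄`
(variable `0` is `x`). Silverman, *AEC*, III.1, Table 3.1. [cite: SilvermanAEC2009, III.1 Table 3.1] -/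
def toXPoly : MvPolynomial (Fin 2) (AlgebraicClosure K) :=
  MvPolynomial.C (((C.map (algebraMap K (AlgebraicClosure K))).u⁻¹ : (AlgebraicClosure K)ˣ) ^ 2 :
      AlgebraicClosure K) *
    (X 0 - MvPolynomial.C (C.map (algebraMap K (AlgebraicClosure K))).r)

/-- The new `y`-coordinate `u⁻³(y - s(x - r) - t)` as a polynomial in `x, y` with coefficients in
`K̄` (variable `0` is `x`, variable `1` is `y`). Silverman, *AEC*, III.1, Table 3.1.
[cite: SilvermanAEC2009, III.1 Table 3.1] -/
def toYPoly : MvPolynomial (Fin 2) (AlgebraicClosure K) :=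
  MvPolynomial.C (((C.map (algebraMap K (AlgebraicClosure K))).u⁻¹ : (AlgebraicClosure K)ˣ) ^ 3 :
      AlgebraicClosure K) *
    (X 1 - MvPolynomial.C (C.map (algebraMap K (AlgebraicClosure K))).s *
        (X 0 - MvPolynomial.C (C.map (algebraMap K (AlgebraicClosure K))).r) -
      MvPolynomial.C (C.map (algebraMap K (AlgebraicClosure K))).t)

/-- `toXPoly` evaluates at `(x, y)` to `C_{K̄}.toX x = u⁻²(x - r)`. [folklore] -/
@[simp]
theorem eval_toXPoly (x y : AlgebraicClosure K) :
    eval ![x, y] (toXPoly C) = (C.map (algebraMap K (AlgebraicClosure K))).toX x := by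
  simp [toXPoly, toX_def]

/-- `toYPoly` evaluates at `(x, y)` to `C_{K̄}.toY x y = u⁻³(y - s(x - r) - t)`. [folklore] -/
@[simp]
theorem eval_toYPoly (x y : AlgebraicClosure K) :
    eval ![x, y] (toYPoly C) = (C.map (algebraMap K (AlgebraicClosure K))).toY x y := by
  simp [toYPoly, toY_def]

/-! ## The substitution on geometric points is algebraic -/

/-- The substitution isomorphism `W(K̄) ≃+ (C • W)(K̄)` agrees with the polynomial map
`(toXPoly C / 1, toYPoly C / 1)` at every affine point `P ≠ O` (its value there is the affine
point `(u⁻²(x - r), u⁻³(y - s(x - r) - t))`, `VariableChange.pointEquivBaseChange_some`).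
Silverman, *AEC*, III.1. [folklore] -/
theorem agreesWithRationalMapAt_pointEquivBaseChange {P : W.geomPoints} (hP : P ≠ 0) :
    AgreesWithRationalMapAt W (C • W) (toXPoly C) 1 (toYPoly C) 1
      (fun Q : W.geomPoints =>
        (pointEquivBaseChange W C (AlgebraicClosure K) Q : (C • W).geomPoints)) P := by
  rcases P with _ | ⟨x, y, h⟩
  · exact absurd rfl hP
  · exact agreesWithRationalMapAt_some_of_eq h _
      (pointEquivBaseChange_some W C (AlgebraicClosure K) h) (by simp) (by simp) (by simp) (by simp)

/-- The substitution isomorphism `W(K̄) ≃+ (C • W)(K̄)` is algebraic in the sense of the prelude's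
`IsAlgebraicOn` (formulae `(toXPoly C, 1, toYPoly C, 1)`, exceptional set `⊆ {O}`).
Silverman, *AEC*, III.1 and III.4. [folklore] -/
theorem isAlgebraicOn_pointEquivBaseChange :
    IsAlgebraicOn W (C • W) (fun Q : W.geomPoints =>
      (pointEquivBaseChange W C (AlgebraicClosure K) Q : (C • W).geomPoints)) :=
  ⟨toXPoly C, 1, toYPoly C, 1, (Set.finite_singleton (0 : W.geomPoints)).subset fun P hP => by
    by_contra h0
    exact hP (agreesWithRationalMapAt_pointEquivBaseChange W C h0)⟩

/-! ## The isogeny `W → C • W` -/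

/-- **The isogeny of an admissible change of variables.** For `C = (u, r, s, t)` over `K`, the
isomorphism `W ≅ C • W`, `(x, y) ↦ (u⁻²(x - r), u⁻³(y - s(x - r) - t))` (Silverman, *AEC*,
III.3.1(b)), as a term of the prelude's `Isogeny W (C • W)`: the substitution isomorphism of
`K̄`-points `VariableChange.pointEquivBaseChange W C K̄`, algebraic by
`isAlgebraicOn_pointEquivBaseChange`, `Γ_K`-equivariant by
`VariableChange.pointEquivBaseChange_map_algEquiv`, with trivial (hence finite) kernel. (An
isomorphism fixing `O` is an isogeny: Silverman, *AEC*, III.4, Definition; it is the object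
`(Isogeny.id W).smul C` of `ComplexMultiplicationBSDTripleProofs.lean`, see the module docstring.)
[cite: SilvermanAEC2009, III.3.1(b), III.4 (Def.) and II.2.4.1] -/
def toIsogeny : Isogeny W (C • W) where
  toAddMonoidHom := (pointEquivBaseChange W C (AlgebraicClosure K)).toAddMonoidHom
  isAlgebraic := isAlgebraicOn_pointEquivBaseChange W C
  equivariant σ P := pointEquivBaseChange_map_algEquiv W C σ P
  finite_ker := by
    refine (Set.finite_singleton (0 : W.geomPoints)).subset fun P hP => ?_
    have hP' : pointEquivBaseChange W C (AlgebraicClosure K) P = 0 := hP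
    exact (pointEquivBaseChange W C (AlgebraicClosure K)).map_eq_zero_iff.mp hP'

/-- The isogeny of a change of variables acts on `E(K̄)` by the substitution isomorphism
`VariableChange.pointEquivBaseChange W C K̄`. [folklore] -/
@[simp]
theorem toIsogeny_apply (P : W.geomPoints) :
    toIsogeny W C P = pointEquivBaseChange W C (AlgebraicClosure K) P :=
  rfl

/-- The isogeny of a change of variables on an affine point:
`(x, y) ↦ (u⁻²(x - r), u⁻³(y - s(x - r) - t))`. Silverman, *AEC*, III.1.
[cite: SilvermanAEC2009, III.1 Table 3.1] -/
theorem toIsogeny_some {x y : AlgebraicClosure K}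
    (h : (W.baseChange (AlgebraicClosure K)).toAffine.Nonsingular x y) :
    toIsogeny W C (Affine.Point.some x y h : W.geomPoints) =
      (Affine.Point.some ((C.map (algebraMap K (AlgebraicClosure K))).toX x)
        ((C.map (algebraMap K (AlgebraicClosure K))).toY x y)
        ((baseChange_smul_eq W C (AlgebraicClosure K)) ▸
          (nonsingular_iff (W.baseChange (AlgebraicClosure K))
            (C.map (algebraMap K (AlgebraicClosure K))) x y).mpr h) : (C • W).geomPoints) :=
  pointEquivBaseChange_some W C (AlgebraicClosure K) h

/-- The isogeny of a change of variables is injective (it is an isomorphism of groups of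
`K̄`-points). Silverman, *AEC*, III.3.1(b). [folklore] -/
theorem toIsogeny_injective : Function.Injective (toIsogeny W C) :=
  (pointEquivBaseChange W C (AlgebraicClosure K)).injective

/-- The isogeny of a change of variables is surjective. Silverman, *AEC*, III.3.1(b). [folklore] -/
theorem toIsogeny_surjective : Function.Surjective (toIsogeny W C) :=
  (pointEquivBaseChange W C (AlgebraicClosure K)).surjective

/-- The kernel of the isogeny of a change of variables is trivial. [folklore] -/
theorem ker_toIsogeny : (toIsogeny W C).toAddMonoidHom.ker = ⊥ :=
  (AddMonoidHom.ker_eq_bot_iff _).mpr (toIsogeny_injective W C)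

/-- The isogeny of a change of variables has degree (`= #ker`, the prelude's `Isogeny.degree`)
one (an isomorphism has trivial kernel; cf. Silverman, *AEC*, II.2.4.1: the maps of degree one
between smooth curves are the isomorphisms). [cite: SilvermanAEC2009, III.4 (Def.) and II.2.4.1] -/
theorem degree_toIsogeny : (toIsogeny W C).degree = 1 := by
  unfold Isogeny.degree
  rw [ker_toIsogeny]
  simp

/-- The isogeny of a change of variables is cyclic (its kernel `{O}` is a cyclic group), in the
sense of the prelude's `Isogeny.IsCyclic`. [folklore] -/
theorem isCyclic_toIsogeny : (toIsogeny W C).IsCyclic := by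
  unfold Isogeny.IsCyclic
  rw [ker_toIsogeny]
  infer_instance

end VariableChange

/-! ## Isomorphic Weierstrass curves are isogenous -/

/-- **A Weierstrass curve is isogenous over `K` to each of its `K`-isomorphic models**:
`W ~ C • W` for every admissible change of variables `C` over `K` (the isogeny
`VariableChange.toIsogeny W C`). Silverman, *AEC*, III.3.1(b) (the change of variables is an
isomorphism) and III.4, Definition (an isomorphism fixing `O` is an isogeny).
[cite: SilvermanAEC2009, III.3.1(b), III.4 (Def.) and II.2.4.1] -/
theorem isIsogenous_smul : IsIsogenous W (C • W) :=
  ⟨VariableChange.toIsogeny W C⟩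

/-- `C • W ~ W`: the inverse change of variables `C⁻¹` gives the isogeny
`C • W → C⁻¹ • (C • W) = W`. Silverman, *AEC*, III.3.1(b) and III.4, Definition.
[cite: SilvermanAEC2009, III.3.1(b), III.4 (Def.) and II.2.4.1] -/
theorem isIsogenous_of_smul : IsIsogenous (C • W) W := by
  simpa only [inv_smul_smul] using isIsogenous_smul (C • W) C⁻¹

/-- Two `K`-isomorphic Weierstrass curves are isogenous over `K`, in the form: if `C • W = W'`
then `W ~ W'`. Silverman, *AEC*, III.3.1(b) and III.4 (Definition). [folklore] -/
theorem isIsogenous_of_smul_eq {W W' : WeierstrassCurve K} {C : VariableChange K}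
    (h : C • W = W') : IsIsogenous W W' :=
  h ▸ isIsogenous_smul W C

/-- Two `K`-isomorphic Weierstrass curves are isogenous over `K`, in the form: if `C • W = W'`
then `W' ~ W`. Silverman, *AEC*, III.3.1(b) and III.4 (Definition). [folklore] -/
theorem isIsogenous_of_smul_eq' {W W' : WeierstrassCurve K} {C : VariableChange K}
    (h : C • W = W') : IsIsogenous W' W :=
  h ▸ isIsogenous_of_smul W C

end WeierstrassCurve

end
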